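import Summits.CriticalPhenomena.CardyFormulaZ2.Theorems.CardyMagicRigidityNestingRigidityNeckZ2VirtualEdges
import HarnessLib

/-!
# Crux `NestingRigidity`, line `pinch-resampling` (v4), stub S12: the arc coordinate of the square ring

Crux `Summit.CriticalPhenomena.CardyFormulaZ2.Theses.CardyMagicRigidity.NestingRigidity`
(stmt-CriticalPhenomena-4835), line `pinch-resampling` v4, stub S12 `stub_neckHookupCoarseZ2 : NeckHookupCoarseZ2`.
GEOMETRIC brick of the summation of the necklace bound `ZNodeAbsBoundChainA` (amended plan in the module docstring
of `…NestingRigidityGapEntropy`, worker W6a): the locales of the necklace live on the inner layer of the collar, the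
square ring `{v | |v - x|_∞ = s + 1}` of `ℤ²`, while the gap hierarchy (`…NestingRigidityGapHierarchy`) and its
entropy inequality are one-dimensional.  The bridge is the ARC COORDINATE of the ring of sup-radius `R` (offsets `d`
from the centre with `|d|_∞ = R`), `NeckCoarseZ2.arcPos R d ∈ [0, 8R)`, running clockwise from the top-left corner
`(-R, R) ↦ 0` (top side `[0, 2R]`, right side `(2R, 4R]`, bottom side `(4R, 6R]`, left side `(6R, 8R)`), with its
inverse `NeckCoarseZ2.arcPt R a`:

* `arcPos_nonneg`, `arcPos_lt` — range `[0, 8R)`; `zNorm_arcPt`, `arcPos_arcPt` — `arcPt R a` is the ring point of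
  arc position `a ∈ [0, 8R)`;
* `zNorm_sub_le_arcDist`, `zNorm_sub_le_arcDist'` — the sup distance is at most the CYCLIC arc distance:
  `|d - d'|_∞ ≤ |a - a'|` and `|d - d'|_∞ ≤ 8R - |a - a'|` (sup-diameters of nodes are at most their line spans);
* `arcDist_le_two_mul_zNorm_sub` — conversely `min (|a - a'|, 8R - |a - a'|) ≤ 2 |d - d'|_∞` (line gaps, after
  cutting the cycle inside a largest gap, certify sup-norm separation up to a factor `2`);
* registered anchor `ringArc_quasiIsometry` (the three inequalities and the inverse, packaged).

All proofs are case analyses over the sides (`split_ifs`, then `omega` after `|t| = max t (-t)`).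
-/

noncomputable section

namespace Summit.CriticalPhenomena.CardyFormulaZ2.Cruxes.NestingRigidity.PinchResampling

open Literature.Probability.Percolation Literature.Probability.LatticeModels
open ZPinchLocality

namespace NeckCoarseZ2

/-- The sup norm in coordinates. -/
theorem zNorm_eq (v : Site 2) : zNorm v = max |v 0| |v 1| := rfl

/-- **Arc coordinate** of an offset `d` on the square ring `{|d|_∞ = R}`, clockwise from the top-left corner:
top side `d 1 = R ↦ R + d 0 ∈ [0, 2R]`, right side `d 0 = R ↦ 3R - d 1 ∈ (2R, 4R]`, bottom side
`d 1 = -R ↦ 5R - d 0 ∈ (4R, 6R]`, left side `d 0 = -R ↦ 7R + d 1 ∈ (6R, 8R)`. -/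
def arcPos (R : ℤ) (d : Site 2) : ℤ :=
  if d 1 = R then R + d 0 else if d 0 = R then 3 * R - d 1 else if d 1 = -R then 5 * R - d 0 else 7 * R + d 1

/-- **Ring point of a given arc coordinate** (inverse of `arcPos` on `[0, 8R)`). -/
def arcPt (R a : ℤ) : Site 2 :=
  if a ≤ 2 * R then ![a - R, R] else if a ≤ 4 * R then ![R, 3 * R - a]
    else if a ≤ 6 * R then ![5 * R - a, -R] else ![-R, a - 7 * R]

variable {R : ℤ} {d d' : Site 2}

/-- Coordinates of a ring point: both in `[-R, R]`, one of them `= ±R`. -/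
theorem ring_coords (hd : zNorm d = R) :
    -R ≤ d 0 ∧ d 0 ≤ R ∧ -R ≤ d 1 ∧ d 1 ≤ R ∧ (d 0 = R ∨ d 0 = -R ∨ d 1 = R ∨ d 1 = -R) := by
  rw [zNorm_eq] at hd
  have hR : 0 ≤ R := hd ▸ (abs_nonneg _).trans (le_max_left _ _)
  have h0 : |d 0| ≤ R := hd ▸ le_max_left _ _
  have h1 : |d 1| ≤ R := hd ▸ le_max_right _ _
  rw [abs_le] at h0 h1
  refine ⟨h0.1, h0.2, h1.1, h1.2, ?_⟩
  rcases max_choice |d 0| |d 1| with h | h <;> rw [h] at hd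
  · rcases (abs_eq hR).1 hd with h' | h'
    · exact Or.inl h'
    · exact Or.inr (Or.inl h')
  · rcases (abs_eq hR).1 hd with h' | h'
    · exact Or.inr (Or.inr (Or.inl h'))
    · exact Or.inr (Or.inr (Or.inr h'))

/-- The arc coordinate is nonnegative. -/
theorem arcPos_nonneg (hd : zNorm d = R) : 0 ≤ arcPos R d := by
  obtain ⟨h0, h0', h1, h1', hs⟩ := ring_coords hd
  unfold arcPos
  split_ifs <;> omega

/-- The arc coordinate is `< 8R` (for `R ≥ 1`). -/
theorem arcPos_lt (hR : 1 ≤ R) (hd : zNorm d = R) : arcPos R d < 8 * R := by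
  obtain ⟨h0, h0', h1, h1', hs⟩ := ring_coords hd
  unfold arcPos
  split_ifs <;> omega

/-- **Sup distance ≤ arc distance.** -/
theorem zNorm_sub_le_arcDist (hd : zNorm d = R) (hd' : zNorm d' = R) :
    zNorm (d - d') ≤ |arcPos R d - arcPos R d'| := by
  obtain ⟨h0, h0', h1, h1', hs⟩ := ring_coords hd
  obtain ⟨k0, k0', k1, k1', ks⟩ := ring_coords hd'
  rw [zNorm_sub, max_le_iff, abs_le, abs_le]
  simp only [le_abs, neg_le]
  unfold arcPos
  split_ifs <;> omega

/-- **Sup distance ≤ arc distance the other way round the ring.** -/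
theorem zNorm_sub_le_arcDist' (hd : zNorm d = R) (hd' : zNorm d' = R) :
    zNorm (d - d') ≤ 8 * R - |arcPos R d - arcPos R d'| := by
  obtain ⟨h0, h0', h1, h1', hs⟩ := ring_coords hd
  obtain ⟨k0, k0', k1, k1', ks⟩ := ring_coords hd'
  rw [zNorm_sub, max_le_iff, abs_le, abs_le, abs_eq_max_neg]
  unfold arcPos
  split_ifs <;> omega

/-- **Cyclic arc distance ≤ twice the sup distance.** -/
theorem arcDist_le_two_mul_zNorm_sub (hd : zNorm d = R) (hd' : zNorm d' = R) :
    min |arcPos R d - arcPos R d'| (8 * R - |arcPos R d - arcPos R d'|) ≤ 2 * zNorm (d - d') := by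
  obtain ⟨h0, h0', h1, h1', hs⟩ := ring_coords hd
  obtain ⟨k0, k0', k1, k1', ks⟩ := ring_coords hd'
  rw [zNorm_sub, abs_eq_max_neg, abs_eq_max_neg, abs_eq_max_neg]
  unfold arcPos
  split_ifs <;> omega

variable {a : ℤ}

/-- The point of arc coordinate `a ∈ [0, 8R)` lies on the ring. -/
theorem zNorm_arcPt (ha : 0 ≤ a) (ha' : a < 8 * R) : zNorm (arcPt R a) = R := by
  rw [zNorm_eq]
  unfold arcPt
  split_ifs <;>
    simp only [Matrix.cons_val_zero, Matrix.cons_val_one, Matrix.cons_val_fin_one, abs_eq_max_neg] <;> omega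

/-- `arcPos` inverts `arcPt` below `8R`. -/
theorem arcPos_arcPt (ha' : a < 8 * R) : arcPos R (arcPt R a) = a := by
  unfold arcPt
  split_ifs <;>
    simp only [arcPos, Matrix.cons_val_zero, Matrix.cons_val_one, Matrix.cons_val_fin_one] <;>
    split_ifs <;> omega

/-- The ring point of arc coordinate `a` is within sup distance `|a - arcPos d|` of the ring point `d`. -/
theorem zNorm_arcPt_sub_le (hd : zNorm d = R) (ha : 0 ≤ a) (ha' : a < 8 * R) :
    zNorm (arcPt R a - d) ≤ |a - arcPos R d| := by
  have h := zNorm_sub_le_arcDist (zNorm_arcPt ha ha') hd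
  rwa [arcPos_arcPt ha'] at h

end NeckCoarseZ2

/-- **The arc coordinate of the square ring is a quasi-isometry onto the cycle `ℤ/8R` (registered helper, anchor of this
module on the crux item).**  For offsets `d, d'` on the ring `{|·|_∞ = R}`: `|d - d'|_∞ ≤ |a - a'|`,
`|d - d'|_∞ ≤ 8R - |a - a'|` and `min (|a - a'|) (8R - |a - a'|) ≤ 2 |d - d'|_∞` where `a = arcPos R d`,
`a' = arcPos R d'`; and every `a ∈ [0, 8R)` is the arc coordinate of the ring point `arcPt R a`. -/
theorem ringArc_quasiIsometry : ∀ (R : ℤ) (d d' : Site 2), zNorm d = R → zNorm d' = R → (zNorm (d - d') ≤ |NeckCoarseZ2.arcPos R d - NeckCoarseZ2.arcPos R d'| ∧ zNorm (d - d') ≤ 8 * R - |NeckCoarseZ2.arcPos R d - NeckCoarseZ2.arcPos R d'| ∧ min |NeckCoarseZ2.arcPos R d - NeckCoarseZ2.arcPos R d'| (8 * R - |NeckCoarseZ2.arcPos R d - NeckCoarseZ2.arcPos R d'|) ≤ 2 * zNorm (d - d')) ∧ ∀ a : ℤ, 0 ≤ a → a < 8 * R → zNorm (NeckCoarseZ2.arcPt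 R a) = R ∧ NeckCoarseZ2.arcPos R (NeckCoarseZ2.arcPt R a) = a :=
  fun _ _ _ hd hd' ↦ ⟨⟨NeckCoarseZ2.zNorm_sub_le_arcDist hd hd', NeckCoarseZ2.zNorm_sub_le_arcDist' hd hd',
    NeckCoarseZ2.arcDist_le_two_mul_zNorm_sub hd hd'⟩,
    fun _ ha ha' ↦ ⟨NeckCoarseZ2.zNorm_arcPt ha ha', NeckCoarseZ2.arcPos_arcPt ha'⟩⟩

end Summit.CriticalPhenomena.CardyFormulaZ2.Cruxes.NestingRigidity.PinchResampling

end
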